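import Literature.Probability.RandomPlanarGeometry.ObservableDrivingMartingales
import Literature.Probability.RandomPlanarGeometry.LoewnerPointFlow
import Literature.Probability.Process.StoppedMartingale
import HarnessLib

/-!
# The FK observable up to CDHKS's time horizon: pathwise regularity and optional stopping

Topic `Probability/RandomPlanarGeometry` (deterministic Loewner calculus + a thin probabilistic
layer). This file serves layer 5 of the decomposition of crit-ising.S17 (FK)
(`Literature.Probability.LatticeModels.convergesInLawToSLE_sixteen_thirds_fkInterface`;
Chelkak–Duminil-Copin–Hongler–Kemppainen–Smirnov, C. R. Math. 352 (2014), Thm. 2): the passage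
from the printed martingale statement of CDHKS, §3,

> "for any `z ∈ Ω`, the process `M_t(z) = (∂_z[-G_t(w(z))⁻¹])^{1/2}`, `t ≤ T(z)`, where
> `G_t(w) = g_t(w) - W_t` and `T(z) = (1/9)(Im w(z))²`, is a martingale with respect to the
> filtration `(ℱ_t)_{t≥0}` generated by `W_t`. … It is easy to see that, for all driving terms,
> `Im G_t(w) ≥ 2√t`, as long as `Im w ≥ 3√t`",

(FK form: Duminil-Copin–Smirnov, Clay Math. Proc. 15 (2012), p. 29, `√π M_t^z =
√(g_t'(z)/(g_t(z) - W_t))`) to the *stopped* form "(5) [`= M_{t∧τ}(z)`] is a martingale" used by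
the tree's extraction theorem `Loewner.martingale_driver_of_fkObservable`
(`ObservableDrivingMartingales.lean`, stopped observable `Loewner.stoppedObservable` at `z = iy`,
far-field stopping time `τ_y = Loewner.farStopTime`). Everything here is PROVED:

* `Loewner.lt_swallowingTime_of_four_mul_lt`: a point `z ∈ ℍ` is not swallowed before time
  `(Im z)²/4`, indeed `(Im g_s(z))² ≥ (Im z)² - 4s` (`IsSolution.im_sq_sub_le`: `(Im g)² + 4s` is
  non-decreasing along the flow) — the quoted "`Im G_t(w) ≥ 2√t` as long as `Im w ≥ 3√t`";
* `Loewner.ShortTime W z t` (`9t ≤ (Im z)²`, no bound on the driver): `Im g_s ≥ (2/3) Im z`,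
  `g_t'(z) = exp ∫₀ᵗ -2/(g_s - W_s)²` with `‖∫‖ ≤ 1/2`, `‖g_t'‖ ≤ 2`, continuity of
  `s ↦ g_s(z), g_s'(z)` on `[0, t]`;
* on the imaginary axis the square `iy g_t'/(g_t - W_t)` of the FK observable stays in the slit
  plane (`ShortTime.base_mem_slitPlane`), so the principal square root `Loewner.fkObservable` is
  the continuous branch: `s ↦ O_s(iy)` is continuous on `[0, y²/9]` and bounded by `2`
  (`ShortTime.continuousOn_fkObservable`, `ShortTime.norm_fkObservable_le`);
* `Loewner.cdhksTime y = y²/9`, the time-limited observable process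
  `Loewner.observableProcess W y t ω = O_{t ∧ y²/9}(iy)` (continuous paths, bounded by `2`),
  `τ_y ≤ (y/128)² ≤ y²/9` (`farStopTime_le_cdhksTime`) and
  `stoppedProcess (observableProcess W y) τ_y = stoppedObservable W y`;
* **optional stopping** (`Loewner.martingale_re_stoppedObservable`,
  `Loewner.martingale_im_stoppedObservable`): if `Re`/`Im` of the time-limited observable process
  is a martingale for a filtration to which `W` (continuous paths) is adapted, then so is `Re`/`Im`
  of the stopped observable — by the tree's optional stopping theorem for a.s.-continuous
  martingales in a raw filtration (`Martingale.isAEMartingale_stoppedProcess`, Le Gall Cor. 3.24)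
  and strong adaptedness of stopped continuous adapted processes (Mathlib
  `StronglyAdapted.stoppedProcess`).

## References

* D. Chelkak, H. Duminil-Copin, C. Hongler, A. Kemppainen, S. Smirnov, *Convergence of Ising
  interfaces to Schramm's SLE curves*, C. R. Math. Acad. Sci. Paris 352 (2014) 157–161, §3.
* H. Duminil-Copin, S. Smirnov, *Conformal invariance of lattice models*, Clay Math. Proc. 15
  (2012), proof of Prop. 6.7 (p. 29).
* G. F. Lawler, *Conformally Invariant Processes in the Plane*, AMS (2005), Ch. 4 §4.1.
* J.-F. Le Gall, *Brownian Motion, Martingales, and Stochastic Calculus* (2016), Thm 3.22,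
  Cor. 3.24.
-/

noncomputable section

open Set Filter Topology Metric MeasureTheory Complex
open scoped NNReal

namespace Literature.Probability.RandomPlanarGeometry

namespace Loewner

variable {W : ℝ≥0 → ℝ} {z : ℂ} {g : ℝ → ℂ} {T : WithTop ℝ≥0}

/-! ### The imaginary part does not collapse before time `(Im z)²/4` -/

/-- Along a solution of the Loewner equation started in `ℍ`, `s ↦ (Im g_s)² + 4 s` is
non-decreasing on the time domain: `d/ds (Im g)² = -4 (Im g)²/|g - W|² ≥ -4`. [folklore] -/
theorem IsSolution.monotoneOn_im_sq_add (h : IsSolution W z g T) :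
    MonotoneOn (fun s ↦ (g s).im ^ 2 + 4 * s) {t : ℝ | 0 ≤ t ∧ (t.toNNReal : WithTop ℝ≥0) < T} := by
  set D : Set ℝ := {t : ℝ | 0 ≤ t ∧ (t.toNNReal : WithTop ℝ≥0) < T} with hD
  have hconv : Convex ℝ D := (ordConnected_timeDomain T).convex
  have hy : ∀ s ∈ D, HasDerivWithinAt (fun s ↦ (g s).im)
      (-2 * (g s).im / Complex.normSq (g s - W s.toNNReal)) D s := fun s hs ↦ by
    have h2 : HasDerivWithinAt (fun s ↦ (g s).im) (vectorField W s (g s)).im D s :=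
      Complex.imCLM.hasFDerivAt.comp_hasDerivWithinAt s (h.isIntegralCurveOn s hs)
    rwa [im_vectorField] at h2
  have hF : ∀ s ∈ D, HasDerivWithinAt (fun s ↦ (g s).im ^ 2 + 4 * s)
      (2 * (g s).im * (-2 * (g s).im / Complex.normSq (g s - W s.toNNReal)) + 4) D s := by
    intro s hs
    have h1 := (hy s hs).pow 2
    have h2 : HasDerivWithinAt (fun s : ℝ ↦ 4 * s) 4 D s := by
      simpa using (hasDerivWithinAt_id s D).const_mul (4 : ℝ)
    refine (h1.add h2).congr_deriv ?_
    push_cast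
    ring
  refine monotoneOn_of_hasDerivWithinAt_nonneg hconv (fun s hs ↦ (hF s hs).continuousWithinAt)
    (fun s hs ↦ (hF s (interior_subset hs)).mono interior_subset) fun s hs ↦ ?_
  have hle : (g s).im ^ 2 ≤ Complex.normSq (g s - W s.toNNReal) := by
    rw [Complex.normSq_apply]
    have him : (g s - (W s.toNNReal : ℂ)).im = (g s).im := by simp
    rw [him]
    nlinarith [mul_self_nonneg ((g s - (W s.toNNReal : ℂ)).re)]
  rcases eq_or_lt_of_le (Complex.normSq_nonneg (g s - W s.toNNReal)) with h0 | hpos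
  · rw [← h0]
    simp
  · have hq : (g s).im ^ 2 / Complex.normSq (g s - W s.toNNReal) ≤ 1 := (div_le_one hpos).2 hle
    have : 2 * (g s).im * (-2 * (g s).im / Complex.normSq (g s - W s.toNNReal)) =
        -4 * ((g s).im ^ 2 / Complex.normSq (g s - W s.toNNReal)) := by ring
    rw [this]
    linarith

/-- **`(Im z)² - 4s ≤ (Im g_s)²` along a solution** (any continuous or discontinuous driving
function), for `s` in the time domain. [folklore] -/
theorem IsSolution.im_sq_sub_le (h : IsSolution W z g T) {s : ℝ} (hs0 : 0 ≤ s)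
    (hsT : (s.toNNReal : WithTop ℝ≥0) < T) : z.im ^ 2 - 4 * s ≤ (g s).im ^ 2 := by
  have h0 : (0 : ℝ) ∈ {t : ℝ | 0 ≤ t ∧ (t.toNNReal : WithTop ℝ≥0) < T} :=
    ⟨le_rfl, lt_of_le_of_lt (by simp) hsT⟩
  have := h.monotoneOn_im_sq_add h0 ⟨hs0, hsT⟩ hs0
  simp only [h.apply_zero, mul_zero, add_zero] at this
  linarith

/-- **A point of `ℍ` is not swallowed before time `(Im z)²/4`**: `4t < (Im z)²` implies
`t < T_z` (continuous driving function). Otherwise `T_z = b ≤ t`, and along the maximal solution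
`Im g_s ≥ √((Im z)² - 4b) > 0` for `s < b`, contradicting `Im g_s → 0` as `s ↑ b`
(`imFlowStop_lt_of_near_swallowingTime`). (CDHKS 2014, §3: "for all driving terms,
`Im G_t(w) ≥ 2√t` as long as `Im w ≥ 3√t`".) [cite: CDHKSCRAS2014, §3] -/
theorem lt_swallowingTime_of_four_mul_lt (hW : Continuous W) (hz : 0 < z.im) {t : ℝ≥0}
    (ht : 4 * (t : ℝ) < z.im ^ 2) : (t : WithTop ℝ≥0) < swallowingTime W z := by
  by_contra hle
  rw [not_lt] at hle
  have hne : swallowingTime W z ≠ ⊤ := ne_top_of_le_ne_top WithTop.coe_ne_top hle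
  obtain ⟨b, hb⟩ := WithTop.ne_top_iff_exists.1 hne
  have hb' : swallowingTime W z = b := hb.symm
  have hbt : b ≤ t := by
    have := hle; rw [hb'] at this; exact_mod_cast this
  have hbt' : (b : ℝ) ≤ t := by exact_mod_cast hbt
  set ε : ℝ := Real.sqrt (z.im ^ 2 - 4 * b) with hε
  have hεpos : 0 < ε := Real.sqrt_pos.2 (by linarith)
  obtain ⟨s, hsb, hs⟩ := imFlowStop_lt_of_near_swallowingTime hW hz hb' hεpos
  have hlt := hs s le_rfl hsb
  have hsT : (s : WithTop ℝ≥0) < swallowingTime W z := by rw [hb']; exact_mod_cast hsb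
  rw [imFlowStop_of_lt hsT] at hlt
  have hz0 : z ≠ W 0 := by
    intro h; rw [h, ofReal_im] at hz; exact lt_irrefl _ hz
  obtain ⟨g, hg⟩ := exists_isSolution_swallowingTime_holds hW hz0
  rw [map_eq_of_isSolution hW hg hsT] at hlt
  have h1 := hg.im_sq_sub_le (s := s) s.coe_nonneg (by simpa using hsT)
  have hpos : 0 < (g s).im := IsSolution.im_pos_holds hW hg hz s s.coe_nonneg (by simpa using hsT)
  have hsb' : (s : ℝ) < b := by exact_mod_cast hsb
  have h2 : ε ≤ (g s).im := by
    rw [hε, ← Real.sqrt_sq hpos.le]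
    exact Real.sqrt_le_sqrt (by linarith)
  linarith

/-- `(Im z)² - 4t ≤ (Im g_t(z))²` for the Loewner map, `4t < (Im z)²`. [folklore] -/
theorem im_sq_sub_le_im_map_sq (hW : Continuous W) (hz : 0 < z.im) {t : ℝ≥0}
    (ht : 4 * (t : ℝ) < z.im ^ 2) : z.im ^ 2 - 4 * t ≤ (map W t z).im ^ 2 := by
  have htT := lt_swallowingTime_of_four_mul_lt hW hz ht
  have hz0 : z ≠ W 0 := by
    intro h; rw [h, ofReal_im] at hz; exact lt_irrefl _ hz
  obtain ⟨g, hg⟩ := exists_isSolution_swallowingTime_holds hW hz0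
  rw [map_eq_of_isSolution hW hg htT]
  exact hg.im_sq_sub_le t.coe_nonneg (by simpa using htT)


/-! ### An elementary slit-plane criterion -/

/-- If `Re u > 0` and `|Im J| < π/2` then `u · exp J` lies in the slit plane `ℂ ∖ (-∞, 0]`: its
argument is `arg u + Im J ∈ (-π, π)`. (Used to see that the principal square root is the
continuous branch of the FK observable on the imaginary axis.) [folklore] -/
theorem mul_exp_mem_slitPlane {u J : ℂ} (hu : 0 < u.re) (hJ : |J.im| < Real.pi / 2) :
    u * exp J ∈ slitPlane := by
  have hcos : 0 < Real.cos J.im :=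
    Real.cos_pos_of_mem_Ioo ⟨by linarith [neg_abs_le J.im], by linarith [le_abs_self J.im]⟩
  have key : (u * exp J).re * Real.cos J.im + (u * exp J).im * Real.sin J.im =
      u.re * Real.exp J.re := by
    calc (u * exp J).re * Real.cos J.im + (u * exp J).im * Real.sin J.im
        = u.re * Real.exp J.re * (Real.sin J.im ^ 2 + Real.cos J.im ^ 2) := by
          rw [mul_re, mul_im, exp_re, exp_im]; ring
      _ = u.re * Real.exp J.re := by rw [Real.sin_sq_add_cos_sq, mul_one]
  rw [mem_slitPlane_iff]
  by_cases him : (u * exp J).im = 0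
  · left
    rw [him, zero_mul, add_zero] at key
    have hpos : 0 < (u * exp J).re * Real.cos J.im := by rw [key]; positivity
    exact pos_of_mul_pos_left hpos hcos.le
  · exact Or.inr him

/-- `Re (iy/G) = y · Im G/|G|² > 0` for `y > 0` and `Im G > 0`. [folklore] -/
theorem re_I_mul_div_pos {y : ℝ} (hy : 0 < y) {G : ℂ} (hG : 0 < G.im) : 0 < (I * y / G).re := by
  have hG0 : G ≠ 0 := by rintro rfl; simp at hG
  have hn : 0 < normSq G := normSq_pos.2 hG0
  rw [div_re]
  simp only [mul_re, I_re, ofReal_re, zero_mul, I_im, ofReal_im, mul_zero, sub_zero, zero_div,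
    mul_im, one_mul, zero_add]
  positivity

/-! ### The short-time regime `9t ≤ (Im z)²` (CDHKS's `t ≤ T(z)`) -/

/-- **The short-time regime** of CDHKS at the point `z ∈ ℍ`: `W` continuous, `Im z > 0` and
`9 t ≤ (Im z)²`, i.e. `t ≤ T(z) := (Im z)²/9` (CDHKS 2014, §3: "`M_t(z)`, `t ≤ T(z)` … where
`T(z) = (1/9)(Im w(z))²`"). No bound on the driving function is assumed (contrast
`Loewner.FarRegime`). [cite: CDHKSCRAS2014, §3] -/
structure ShortTime (W : ℝ≥0 → ℝ) (z : ℂ) (t : ℝ≥0) : Prop where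
  /-- The driving function is continuous. -/
  cont : Continuous W
  /-- The point lies in the open upper half-plane. -/
  im_pos : 0 < z.im
  /-- The time is short: `9t ≤ (Im z)²`. -/
  nine : 9 * (t : ℝ) ≤ z.im ^ 2

namespace ShortTime

variable {t : ℝ≥0}

/-- Monotonicity in time. [folklore] -/
theorem mono (h : ShortTime W z t) {s : ℝ≥0} (hs : s ≤ t) : ShortTime W z s :=
  ⟨h.cont, h.im_pos, le_trans (by gcongr) h.nine⟩

/-- `4t < (Im z)²` in the short-time regime. [folklore] -/
theorem four_lt (h : ShortTime W z t) : 4 * (t : ℝ) < z.im ^ 2 := by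
  have := h.nine
  have := h.im_pos
  nlinarith [t.coe_nonneg]

/-- **No swallowing in the short-time regime**: `t < T_z`. [folklore] -/
theorem lt (h : ShortTime W z t) : (t : WithTop ℝ≥0) < swallowingTime W z :=
  lt_swallowingTime_of_four_mul_lt h.cont h.im_pos h.four_lt

/-- Real-time form of `lt`. [folklore] -/
theorem lt' (h : ShortTime W z t) : (((t : ℝ).toNNReal : ℝ≥0) : WithTop ℝ≥0) < swallowingTime W z :=
  toNNReal_coe_lt h.lt

/-- The point is not the initial driving value. [folklore] -/
theorem z_ne_driving (h : ShortTime W z t) : z ≠ W 0 := by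
  intro hz
  have := h.im_pos
  rw [hz, ofReal_im] at this
  exact lt_irrefl _ this

/-- The maximal solution from `z` exists. [folklore] -/
theorem exists_sol (h : ShortTime W z t) : ∃ g, IsSolution W z g (swallowingTime W z) :=
  exists_isSolution_swallowingTime_holds h.cont h.z_ne_driving

/-- **`Im g_s ≥ (2/3) Im z` on `[0, t]`** (from `(Im g_s)² ≥ (Im z)² - 4s ≥ (5/9)(Im z)²`).
(CDHKS 2014, §3: "`Im G_t(w) ≥ 2√t` as long as `Im w ≥ 3√t`".) [cite: CDHKSCRAS2014, §3] -/
theorem im_lower (h : ShortTime W z t) (hg : IsSolution W z g (swallowingTime W z)) {s : ℝ}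
    (hs : s ∈ Icc (0 : ℝ) t) : 2 * z.im / 3 ≤ (g s).im := by
  have hsT : (s.toNNReal : WithTop ℝ≥0) < swallowingTime W z := (Icc_subset_timeDomain h.lt' hs).2
  have h1 := hg.im_sq_sub_le hs.1 hsT
  have hpos : 0 < (g s).im := IsSolution.im_pos_holds h.cont hg h.im_pos s hs.1 hsT
  have h9 := h.nine
  have hy := h.im_pos
  nlinarith [hs.2]

/-- `‖g_s - W_s‖ ≥ (2/3) Im z` on `[0, t]`. [folklore] -/
theorem norm_sub_lower (h : ShortTime W z t) (hg : IsSolution W z g (swallowingTime W z)) {s : ℝ}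
    (hs : s ∈ Icc (0 : ℝ) t) : 2 * z.im / 3 ≤ ‖g s - W s.toNNReal‖ := by
  refine (h.im_lower hg hs).trans ?_
  have := abs_im_le_norm (g s - W s.toNNReal)
  rw [sub_im, ofReal_im, sub_zero] at this
  exact (le_abs_self _).trans this

/-- The solution stays off the driving function on `[0, t]`. [folklore] -/
theorem sub_ne_zero (h : ShortTime W z t) (hg : IsSolution W z g (swallowingTime W z)) {s : ℝ}
    (hs : s ∈ Icc (0 : ℝ) t) : g s - W s.toNNReal ≠ 0 := by
  have := h.norm_sub_lower hg hs
  have hy := h.im_pos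
  exact norm_pos_iff.1 (by linarith)

/-- The exponent integrand is bounded: `‖-2/(g_s - W_s)²‖ ≤ 9/(2 (Im z)²)` on `[0, t]`. [folklore] -/
theorem norm_coeff_le (h : ShortTime W z t) (hg : IsSolution W z g (swallowingTime W z)) {s : ℝ}
    (hs : s ∈ Icc (0 : ℝ) t) :
    ‖(-2 : ℂ) / ((g s - W s.toNNReal) * (g s - W s.toNNReal))‖ ≤ 9 / (2 * z.im ^ 2) := by
  have hG := h.norm_sub_lower hg hs
  have hy := h.im_pos
  have hG0 : 0 < ‖g s - W s.toNNReal‖ := by linarith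
  rw [norm_div, norm_neg, norm_mul, RCLike.norm_ofNat, div_le_div_iff₀ (by positivity) (by positivity)]
  nlinarith [mul_le_mul hG hG (by positivity) (norm_nonneg _)]

/-- **The exponent is small: `‖∫₀ᵗ -2/(g_s - W_s)² ds‖ ≤ 1/2`** in the short-time regime.
[folklore] -/
theorem norm_exponent_le (h : ShortTime W z t) (hg : IsSolution W z g (swallowingTime W z)) :
    ‖∫ s in (0 : ℝ)..t, (-2 : ℂ) / ((g s - W s.toNNReal) * (g s - W s.toNNReal))‖ ≤ 1 / 2 := by
  have hy := h.im_pos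
  calc ‖∫ s in (0 : ℝ)..t, (-2 : ℂ) / ((g s - W s.toNNReal) * (g s - W s.toNNReal))‖
      ≤ 9 / (2 * z.im ^ 2) * |(t : ℝ) - 0| := by
        refine intervalIntegral.norm_integral_le_of_norm_le_const fun s hs ↦ ?_
        rw [uIoc_of_le t.coe_nonneg] at hs
        exact h.norm_coeff_le hg ⟨hs.1.le, hs.2⟩
    _ = 9 * t / (2 * z.im ^ 2) := by rw [sub_zero, abs_of_nonneg t.coe_nonneg]; ring
    _ ≤ 1 / 2 := by
        rw [div_le_div_iff₀ (by positivity) (by norm_num)]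
        linarith [h.nine]

/-- **`g_t'(z) = exp ∫₀ᵗ -2/(g_s - W_s)² ds`** in the short-time regime (the tree's
`hasDerivAt_map`; Lawler (2005), Ch. 4 §4.1: `∂_t log g_t'(z) = -2/(g_t(z) - U_t)²`).
[cite: Lawler2005, Ch. 4 §4.1] -/
theorem deriv_map_eq (h : ShortTime W z t) (hg : IsSolution W z g (swallowingTime W z)) :
    deriv (map W t) z =
      exp (∫ s in (0 : ℝ)..t, (-2 : ℂ) / ((g s - W s.toNNReal) * (g s - W s.toNNReal))) :=
  (hasDerivAt_map h.cont h.lt hg).deriv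

/-- `e^{1/2} ≤ 2` (from `1 + x ≤ eˣ` at `x = -1/2`). [folklore] -/
theorem exp_half_le_two : Real.exp (1 / 2) ≤ 2 := by
  have h1 : (1 : ℝ) / 2 ≤ Real.exp (-(1 / 2)) := by
    have := Real.add_one_le_exp (-(1 / 2 : ℝ)); linarith
  have h2 : Real.exp (1 / 2) = (Real.exp (-(1 / 2)))⁻¹ := by
    rw [Real.exp_neg, inv_inv]
  rw [h2, inv_le_comm₀ (Real.exp_pos _) (by norm_num)]
  simpa using h1

/-- `‖g_t'(z)‖ ≤ 2` in the short-time regime (`e^{1/2} ≤ 2`). [folklore] -/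
theorem norm_deriv_map_le (h : ShortTime W z t) : ‖deriv (map W t) z‖ ≤ 2 := by
  obtain ⟨g, hg⟩ := h.exists_sol
  rw [h.deriv_map_eq hg, norm_exp]
  have h1 := h.norm_exponent_le hg
  have h2 := (re_le_norm _).trans h1
  exact (Real.exp_le_exp.2 h2).trans exp_half_le_two

/-- `g_t(z) - W_t ≠ 0`. [folklore] -/
theorem map_sub_ne_zero (h : ShortTime W z t) : map W t z - W t ≠ 0 := by
  obtain ⟨g, hg⟩ := h.exists_sol
  rw [map_eq_of_isSolution h.cont hg h.lt]
  simpa using h.sub_ne_zero hg (s := t) ⟨t.coe_nonneg, le_rfl⟩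

/-- `‖g_t(z) - W_t‖ ≥ (2/3) Im z`. [folklore] -/
theorem norm_map_sub_lower (h : ShortTime W z t) : 2 * z.im / 3 ≤ ‖map W t z - W t‖ := by
  obtain ⟨g, hg⟩ := h.exists_sol
  rw [map_eq_of_isSolution h.cont hg h.lt]
  simpa using h.norm_sub_lower hg (s := t) ⟨t.coe_nonneg, le_rfl⟩

/-- `Im (g_t(z) - W_t) > 0`. [folklore] -/
theorem im_map_sub_pos (h : ShortTime W z t) : 0 < (map W t z - W t).im := by
  rw [sub_im, ofReal_im, sub_zero]
  exact im_map_pos_of_lt h.cont h.im_pos h.lt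

/-! ### Continuity in time -/

/-- `s ↦ g_s(z)` is continuous on `[0, t]`. [folklore] -/
theorem continuousOn_map (h : ShortTime W z t) : ContinuousOn (fun s : ℝ≥0 ↦ map W s z) (Icc 0 t) :=
  (continuousOn_map_left h.cont h.z_ne_driving).mono fun _ hs ↦ (h.mono hs.2).lt

/-- **`s ↦ g_s'(z)` is continuous on `[0, t]`** (the exponent is the integral of a continuous
function). [folklore] -/
theorem continuousOn_deriv_map (h : ShortTime W z t) :
    ContinuousOn (fun s : ℝ≥0 ↦ deriv (map W s) z) (Icc 0 t) := by
  obtain ⟨g, hg⟩ := h.exists_sol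
  set f : ℝ → ℂ := fun s ↦ (-2 : ℂ) / ((g s - W s.toNNReal) * (g s - W s.toNNReal)) with hf
  have hfc : ContinuousOn f (Icc 0 t) := IsSolution.continuousOn_coeff h.cont hg hg h.lt' h.lt'
  have hprim : ContinuousOn (fun b : ℝ ↦ ∫ u in (0 : ℝ)..b, f u) (Icc 0 t) := by
    have hint : IntervalIntegrable f volume (0 : ℝ) t := hfc.intervalIntegrable_of_Icc t.coe_nonneg
    have := intervalIntegral.continuousOn_primitive_interval' hint left_mem_uIcc
    rwa [uIcc_of_le t.coe_nonneg] at this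
  have h2 : ContinuousOn (fun s : ℝ≥0 ↦ exp (∫ u in (0 : ℝ)..(s : ℝ), f u)) (Icc 0 t) :=
    continuous_exp.comp_continuousOn (hprim.comp NNReal.continuous_coe.continuousOn
      fun s hs ↦ ⟨s.coe_nonneg, NNReal.coe_le_coe.2 hs.2⟩)
  exact h2.congr fun s hs ↦ (h.mono hs.2).deriv_map_eq hg

/-- `s ↦ z g_s'(z)/(g_s(z) - W_s)` (the square of the FK observable) is continuous on `[0, t]`.
[folklore] -/
theorem continuousOn_base (h : ShortTime W z t) :
    ContinuousOn (fun s : ℝ≥0 ↦ z * deriv (map W s) z / (map W s z - W s)) (Icc 0 t) :=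
  (continuousOn_const.mul h.continuousOn_deriv_map).div
    (h.continuousOn_map.sub (continuous_ofReal.comp h.cont).continuousOn)
    fun _ hs ↦ (h.mono hs.2).map_sub_ne_zero

/-! ### On the imaginary axis: the principal branch is the continuous branch -/

/-- **On the imaginary axis the square of the observable avoids the negative axis**: for
`z = iy`, `y > 0`, in the short-time regime, `iy g_t'(iy)/(g_t(iy) - W_t) ∈ ℂ ∖ (-∞, 0]`.
Indeed `iy/(g_t - W_t)` has positive real part and `g_t' = e^J` with `|Im J| ≤ 1/2 < π/2`.
Consequently the principal square root `Loewner.fkObservable` is continuous in `t` there, i.e.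
it is the branch "continuous in `t` from the value `1` at `t = 0`" of DCS/CDHKS. [folklore] -/
theorem base_mem_slitPlane {y : ℝ} (h : ShortTime W (I * y) t) :
    I * y * deriv (map W t) (I * y) / (map W t (I * y) - W t) ∈ slitPlane := by
  obtain ⟨g, hg⟩ := h.exists_sol
  have hy : 0 < y := by simpa using h.im_pos
  rw [h.deriv_map_eq hg, mul_div_right_comm]
  refine mul_exp_mem_slitPlane (re_I_mul_div_pos hy h.im_map_sub_pos) ?_
  refine lt_of_le_of_lt ((abs_im_le_norm _).trans (h.norm_exponent_le hg)) ?_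
  linarith [Real.two_le_pi]

/-- **The FK observable `t ↦ (iy g_t'(iy)/(g_t(iy) - W_t))^{1/2}` is continuous on `[0, t]`** in
the short-time regime (principal branch = continuous branch on the imaginary axis). [folklore] -/
theorem continuousOn_fkObservable {y : ℝ} (h : ShortTime W (I * y) t) :
    ContinuousOn (fun s : ℝ≥0 ↦ fkObservable W s (I * y)) (Icc 0 t) :=
  h.continuousOn_base.cpow_const fun _ hs ↦ (h.mono hs.2).base_mem_slitPlane

/-- **The FK observable is bounded by `2`** on the imaginary axis in the short-time regime:
`‖iy g'/(g - W)‖ ≤ y · 2/((2/3) y) = 3` and `√3 ≤ 2`. (CDHKS 2014, §3: "`M_t^δ(z)` are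
uniformly bounded … if `t ≤ (1/9)(Im w(z))²`".) [cite: CDHKSCRAS2014, §3] -/
theorem norm_fkObservable_le {y : ℝ} (h : ShortTime W (I * y) t) : ‖fkObservable W t (I * y)‖ ≤ 2 := by
  have hy : 0 < y := by simpa using h.im_pos
  set b := I * y * deriv (map W t) (I * y) / (map W t (I * y) - W t) with hb
  have hbase : ‖b‖ ≤ 3 := by
    have hG := h.norm_map_sub_lower
    have hIy : (I * (y : ℂ)).im = y := by simp
    rw [hIy] at hG
    have hG0 : 0 < ‖map W t (I * y) - W t‖ := by linarith
    rw [hb, norm_div, norm_mul, div_le_iff₀ hG0]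
    have h1 : ‖I * (y : ℂ)‖ = y := by simp [abs_of_pos hy]
    rw [h1]
    have h2 := h.norm_deriv_map_le
    nlinarith [norm_nonneg (deriv (map W t) (I * y))]
  have hcpow : ‖fkObservable W t (I * y)‖ = Real.sqrt ‖b‖ := by
    rw [fkObservable, ← hb, show (2⁻¹ : ℂ) = ((2⁻¹ : ℝ) : ℂ) by norm_num, norm_cpow_real,
      Real.sqrt_eq_rpow, one_div]
  rw [hcpow]
  calc Real.sqrt ‖b‖ ≤ Real.sqrt 4 := Real.sqrt_le_sqrt (by linarith)
    _ = 2 := by rw [show (4 : ℝ) = 2 ^ 2 by norm_num, Real.sqrt_sq (by norm_num)]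

end ShortTime

/-! ### The CDHKS time `T(iy) = y²/9` and the time-limited observable path -/

/-- **CDHKS's time horizon** `T(iy) = y²/9` for the point `iy` (CDHKS 2014, §3:
`T(z) = (1/9)(Im w(z))²`), as an element of `ℝ≥0`. [cite: CDHKSCRAS2014, §3] -/
def cdhksTime (y : ℝ) : ℝ≥0 := ⟨y ^ 2 / 9, by positivity⟩

/-- `cdhksTime y = y²/9` as a real number. [folklore] -/
@[simp] theorem coe_cdhksTime (y : ℝ) : ((cdhksTime y : ℝ≥0) : ℝ) = y ^ 2 / 9 := rfl

/-- The whole interval `[0, T(iy)]` is in the short-time regime (`y > 0`, `W` continuous).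
[folklore] -/
theorem shortTime_cdhksTime (hW : Continuous W) {y : ℝ} (hy : 0 < y) :
    ShortTime W (I * y) (cdhksTime y) :=
  ⟨hW, by simpa using hy, by rw [coe_cdhksTime, show (I * (y : ℂ)).im = y by simp]; linarith⟩

/-- `s ∧ T(iy)` is in the short-time regime. [folklore] -/
theorem shortTime_min_cdhksTime (hW : Continuous W) {y : ℝ} (hy : 0 < y) (s : ℝ≥0) :
    ShortTime W (I * y) (min s (cdhksTime y)) :=
  (shortTime_cdhksTime hW hy).mono (min_le_right _ _)

/-- **The time-limited observable path `s ↦ O_{s ∧ T(iy)}(iy)` is continuous on `[0, ∞)`**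
(`W` continuous, `y > 0`). [folklore] -/
theorem continuous_fkObservable_min (hW : Continuous W) {y : ℝ} (hy : 0 < y) :
    Continuous fun s : ℝ≥0 ↦ fkObservable W (min s (cdhksTime y)) (I * y) :=
  (shortTime_cdhksTime hW hy).continuousOn_fkObservable.comp_continuous
    (continuous_id.min continuous_const) fun _ ↦ ⟨bot_le, min_le_right _ _⟩

/-- The time-limited observable is bounded by `2`. [folklore] -/
theorem norm_fkObservable_min_le (hW : Continuous W) {y : ℝ} (hy : 0 < y) (s : ℝ≥0) :
    ‖fkObservable W (min s (cdhksTime y)) (I * y)‖ ≤ 2 :=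
  (shortTime_min_cdhksTime hW hy s).norm_fkObservable_le

end Loewner

end Literature.Probability.RandomPlanarGeometry

/-! ## The time-limited observable process and optional stopping at `τ_y` -/

namespace Literature.Probability.RandomPlanarGeometry

namespace Loewner

open Literature.Probability.Process

variable {Ω : Type*} {m : MeasurableSpace Ω}

/-- **The time-limited FK observable process** at the point `iy`:
`observableProcess W y t ω = O_{t ∧ T(iy)}(iy)`, the FK observable
`Loewner.fkObservable (W · ω) (t ∧ y²/9) (iy) = (iy g'/(g - W))^{1/2}` of the Loewner chain of the
path `W · ω`, frozen at CDHKS's time horizon `T(iy) = y²/9` (`Loewner.cdhksTime`). This is the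
process "`M_t(z)`, `t ≤ T(z)`" of CDHKS (2014), §3 (FK form, DCS 2012 p. 29: `√π M_t^z =
√(g_t'(z)/(g_t(z) - W_t))`), at `z = iy` and up to the `t`-independent factor `√z`.
[cite: CDHKSCRAS2014, §3] -/
def observableProcess (W : ℝ≥0 → Ω → ℝ) (y : ℝ) : ℝ≥0 → Ω → ℂ :=
  fun t ω ↦ fkObservable (fun u ↦ W u ω) (min t (cdhksTime y)) (I * y)

/-- Unfolding of `observableProcess`. [folklore] -/
theorem observableProcess_apply (W : ℝ≥0 → Ω → ℝ) (y : ℝ) (t : ℝ≥0) (ω : Ω) :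
    observableProcess W y t ω = fkObservable (fun u ↦ W u ω) (min t (cdhksTime y)) (I * y) := rfl

variable {W : ℝ≥0 → Ω → ℝ}

/-- **The time-limited observable process has continuous paths** (every `ω`; `W` with continuous
paths, `y > 0`). [folklore] -/
theorem continuous_observableProcess (hWc : ∀ ω, Continuous (W · ω)) {y : ℝ} (hy : 0 < y) (ω : Ω) :
    Continuous fun t ↦ observableProcess W y t ω :=
  continuous_fkObservable_min (hWc ω) hy

/-- The time-limited observable process is bounded by `2`. [folklore] -/
theorem norm_observableProcess_le (hWc : ∀ ω, Continuous (W · ω)) {y : ℝ} (hy : 0 < y) (t : ℝ≥0)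
    (ω : Ω) : ‖observableProcess W y t ω‖ ≤ 2 :=
  norm_fkObservable_min_le (hWc ω) hy t

/-- **`τ_y ≤ T(iy)`**: the far-field stopping time precedes CDHKS's time horizon. At time
`s₀ = (y/128)² ≤ y²/9` the level `128 (√s₀ + |W_{s₀}|) ≥ |y| ≥ y` is reached, so
`τ_y ≤ s₀`. [folklore] -/
theorem farStopTime_le_cdhksTime (hWc : ∀ ω, Continuous (W · ω)) (y : ℝ) (ω : Ω) :
    farStopTime W y ω ≤ (cdhksTime y : WithTop ℝ≥0) := by
  set r : ℝ := (y / 128) ^ 2 with hr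
  have hr0 : 0 ≤ r := sq_nonneg _
  set s₀ : ℝ≥0 := r.toNNReal with hs₀
  have hcoe : (s₀ : ℝ) = r := Real.coe_toNNReal _ hr0
  have hs₀T : s₀ ≤ cdhksTime y := by
    rw [← NNReal.coe_le_coe, hcoe, coe_cdhksTime, hr]
    nlinarith [sq_nonneg y]
  refine (hittingAfter_zero_le_coe_iff (isClosed_farStopSet y) (continuous_clockDriver hWc ω)).2
    ⟨s₀, hs₀T, ?_⟩
  simp only [farStopSet, clockDriver, mem_setOf_eq]
  have h1 : Real.sqrt (s₀ : ℝ) = |y| / 128 := by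
    rw [hcoe, hr, Real.sqrt_sq_eq_abs, abs_div, abs_of_pos (by norm_num : (0 : ℝ) < 128)]
  rw [h1]
  have := le_abs_self y
  have := abs_nonneg (W s₀ ω)
  linarith

/-- **Stopping the time-limited observable at `τ_y` gives the stopped observable**:
`N^y_{t ∧ τ_y} = O_{t ∧ τ_y}` since `τ_y ≤ T(iy)`. [folklore] -/
theorem stoppedProcess_observableProcess (hWc : ∀ ω, Continuous (W · ω)) (y : ℝ) :
    stoppedProcess (observableProcess W y) (farStopTime W y) = stoppedObservable W y := by
  ext t ω
  simp only [stoppedProcess, observableProcess_apply, stoppedObservable]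
  congr 2
  refine min_eq_left ?_
  have h1 := coe_untopA_min_le t (farStopTime W y ω)
  exact WithTop.coe_le_coe.1 (h1.trans (farStopTime_le_cdhksTime hWc y ω))

/-- Real part of the stopping identity. [folklore] -/
theorem stoppedProcess_re_observableProcess (hWc : ∀ ω, Continuous (W · ω)) (y : ℝ) :
    stoppedProcess (fun t ω ↦ (observableProcess W y t ω).re) (farStopTime W y) =
      fun t ω ↦ (stoppedObservable W y t ω).re := by
  ext t ω
  have := congrFun (congrFun (stoppedProcess_observableProcess hWc y) t) ω
  simp only [stoppedProcess] at this ⊢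
  rw [this]

/-- Imaginary part of the stopping identity. [folklore] -/
theorem stoppedProcess_im_observableProcess (hWc : ∀ ω, Continuous (W · ω)) (y : ℝ) :
    stoppedProcess (fun t ω ↦ (observableProcess W y t ω).im) (farStopTime W y) =
      fun t ω ↦ (stoppedObservable W y t ω).im := by
  ext t ω
  have := congrFun (congrFun (stoppedProcess_observableProcess hWc y) t) ω
  simp only [stoppedProcess] at this ⊢
  rw [this]

section Martingale

variable {P : Measure Ω} [IsFiniteMeasure P] {𝓕 : Filtration ℝ≥0 m}

/-- **Optional stopping for a real continuous functional of the observable.** If a real process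
`X` with continuous paths is an `𝓕`-martingale, `W` is `𝓕`-adapted with continuous paths, then
`X` stopped at the far-field stopping time `τ_y` is again an `𝓕`-martingale: it is an a.e.
martingale by optional stopping for a.s.-continuous martingales in a raw filtration
(`Martingale.isAEMartingale_stoppedProcess`, Le Gall Thm 3.22/Cor. 3.24), and it is strongly
adapted as the stopped process of a continuous adapted process (Mathlib
`StronglyAdapted.stoppedProcess`). [cite: Legall2016, Cor. 3.24] -/
theorem martingale_stoppedProcess_farStopTime (hWad : StronglyAdapted 𝓕 W)
    (hWc : ∀ ω, Continuous (W · ω)) (y : ℝ) {X : ℝ≥0 → Ω → ℝ} (hX : Martingale X 𝓕 P)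
    (hXc : ∀ ω, Continuous (X · ω)) : Martingale (stoppedProcess X (farStopTime W y)) 𝓕 P := by
  have hτ := isStoppingTime_farStopTime hWad hWc y
  have hae : IsAEMartingale (stoppedProcess X (farStopTime W y)) 𝓕 P :=
    hX.isAEMartingale_stoppedProcess (ae_of_all _ hXc) hτ.isOptionalTime
  exact ⟨hX.stronglyAdapted.stoppedProcess hXc hτ, fun s t hst ↦ hae.condExp_ae_eq s t hst⟩

/-- **From CDHKS's martingale to the stopped-observable martingale, real part.** If the real part
of the time-limited observable process `t ↦ Re O_{t ∧ T(iy)}(iy)` is an `𝓕`-martingale (`W`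
`𝓕`-adapted with continuous paths, `y > 0`), then so is the real part of the stopped observable
`t ↦ Re O_{t ∧ τ_y}(iy)` of `Loewner.stoppedObservable` (CDHKS 2014, §3: from "`M_t(z)`,
`t ≤ T(z)`, is a martingale" to "(5) [`= M_{t∧τ}(z)`] is a martingale"). [cite: CDHKSCRAS2014, §3] -/
theorem martingale_re_stoppedObservable (hWad : StronglyAdapted 𝓕 W) (hWc : ∀ ω, Continuous (W · ω))
    {y : ℝ} (hy : 0 < y) (h : Martingale (fun t ω ↦ (observableProcess W y t ω).re) 𝓕 P) :
    Martingale (fun t ω ↦ (stoppedObservable W y t ω).re) 𝓕 P := by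
  rw [← stoppedProcess_re_observableProcess hWc y]
  exact martingale_stoppedProcess_farStopTime hWad hWc y h
    fun ω ↦ continuous_re.comp (continuous_observableProcess hWc hy ω)

/-- **From CDHKS's martingale to the stopped-observable martingale, imaginary part.**
[cite: CDHKSCRAS2014, §3] -/
theorem martingale_im_stoppedObservable (hWad : StronglyAdapted 𝓕 W) (hWc : ∀ ω, Continuous (W · ω))
    {y : ℝ} (hy : 0 < y) (h : Martingale (fun t ω ↦ (observableProcess W y t ω).im) 𝓕 P) :
    Martingale (fun t ω ↦ (stoppedObservable W y t ω).im) 𝓕 P := by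
  rw [← stoppedProcess_im_observableProcess hWc y]
  exact martingale_stoppedProcess_farStopTime hWad hWc y h
    fun ω ↦ continuous_im.comp (continuous_observableProcess hWc hy ω)

end Martingale

end Loewner

end Literature.Probability.RandomPlanarGeometry
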